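import Mathlib
import Summits.Ventures.HodgeRepro.Tier4.Target
import Summits.Ventures.HodgeRepro.Tier4.Line3.Defs
import Summits.Ventures.HodgeRepro.Tier4.Line3.LocaliserS
import Summits.Ventures.HodgeRepro.Tier4.Line3.StableLattice
import Summits.Ventures.HodgeRepro.Tier4.Line3.TorusInvariance
import Summits.Ventures.HodgeRepro.Tier4.Line3.InvariantMajorantDef
import Summits.Ventures.HodgeRepro.Tier4.Line3.RayMinor
import Summits.Ventures.HodgeRepro.Tier4.Line3.CrossMinor

/-!
# Tier4/Line3/StableLatticeU — (I2) of the invariant route for the SCALAR-UNION support clause `suppU`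

Blind re-derivation cell `pub-hodge-repro`, Tier 4 «PROVE THE STEP» (README §9–§10), LINE L3, seat t4-L2-p1 g2
(the lineage of StableLattice p673343).  Repair of O-L3-8 (t4-L3-p2 g2 S13369, adjudicated by t4-plan-3 g2 S13393):
`LocS.supp` (support up to the norm-one torus around `xm`) is unsatisfiable on scalar-symmetric data, and the repaired
clause (R1) `suppU` puts the support of the depth-`N` localiser in the deep balls around ALL scalar copies `λ • xm`
that lie in the support lattices.  Rung (I2) — ONE `Γ`-stable lattice `L′ = d⁻¹ 𝒪³` containing `xm` and all the
support lattices, with the support of every depth inside it — survives verbatim: a supported line tuple has a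
representative `x = λ • xm + δ` with `λ • xm ∈ L` and `δ ∈ (𝔭𝔭̄)^N L`, so `x ∈ L ⊆ L′`.

The theorem is stated STRUCTURE-INDEPENDENTLY, on a level function and a family of translates with the `suppU` clause
(plan-3's (R1) text) as an explicit hypothesis, so it applies to `ℓ.level`, `ℓ.loc`, `ℓ.suppU` of whatever localiser
structure `LocSU` the successor planner types, without waiting for it.

v2 (APPEND): the PER-SLOT forms (t4-plan-3 g3's adjudication S13492: one scalar per slot, forced by the per-slot
obstruction LocSScalarObstructionGen p679303).  `exists_stable_lattice_suppU_slot` takes the per-slot clause INLINE in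
t4-x2 g2's `SuppU4` spelling (ScalarFamily.lean, the text of record — it applies to `hsupp : SuppU4 D p xm loc` by
unfolding, no import needed); `exists_stable_lattice_suppSlot` takes t4-L2-p3 g3's `SuppSlot` (CrossMinor p679339) BY
NAME; both with the corollary `x j ∈ L′`.  `exists_gammaStable_supportSet_of_suppSlot` / `…_of_suppU_slot` package what
the family route displays (t4-L2-p3 g3 S13494): a `Γ`-STABLE set of line tuples containing the support of every depth —
the lines of `L′⁴` (`IsGammaStable`, InvariantMajorantDef; `Γ`-stability through `exists_torus_of_lines_eq` and
`mulVec_mem_denomLattice`).  Nothing here asserts anything about the truth of (P); HC_CM is NOT proved by anyone in this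
repository.
-/

set_option autoImplicit false

noncomputable section

namespace Summit.Ventures.HodgeRepro.Tier4.Line3

open Summit.Ventures.HodgeRepro.Tier4
open Matrix NumberField

namespace T4Data

variable (X : T4Data)

/-- **(I2) FOR THE SCALAR-UNION SUPPORT CLAUSE**: under `suppU` (the support of `coefQ (loc N)` lies in the lines of
`λ • xm + (𝔭 𝔭̄)^N L` for some `λ ≠ 0` with `λ • xm ∈ L`, `L` in a finite set of lattices containing `xm`), there is ONE
`Γ`-stable lattice `L′ = d⁻¹ 𝒪³ ∋ xm` with the support of every depth inside `λ • xm + (𝔭 𝔭̄)^N L′`. -/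
theorem exists_stable_lattice_suppU (D : X.ThetaData)
    {p : IsDedekindDomain.HeightOneSpectrum (NumberField.RingOfIntegers X.E)}
    {level : ℕ → X.Level} (loc : ∀ N : ℕ, X.Tr (level N)) (xm : X.Tuple)
    (hsuppU : ∃ S : Finset (Submodule (NumberField.RingOfIntegers X.E) (Fin 3 → X.E)),
      (∀ L ∈ S, X.IsLattice L ∧ ∀ j, xm j ∈ L) ∧
      ∀ N (w : X.LineTuple), X.coefQ D.cf (loc N) (X.rep w) ≠ 0 →
        ∃ (lam : X.E) (x : X.Tuple) (L : Submodule (NumberField.RingOfIntegers X.E) (Fin 3 → X.E)), L ∈ S ∧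
          lam ≠ 0 ∧ (∀ j, lam • xm j ∈ L) ∧
          (∀ j, x j - lam • xm j ∈ (p.asIdeal * X.conjIdeal p.asIdeal) ^ N • L) ∧ X.lines x = w) :
    ∃ d : 𝓞 X.E, d ≠ 0 ∧ X.IsLattice (X.denomLattice d) ∧ (∀ j, xm j ∈ X.denomLattice d) ∧
      (∀ γ ∈ X.Γ, ∀ x ∈ X.denomLattice d, γ *ᵥ x ∈ X.denomLattice d) ∧
      ∀ N (w : X.LineTuple), X.coefQ D.cf (loc N) (X.rep w) ≠ 0 →
        ∃ (lam : X.E) (x : X.Tuple), lam ≠ 0 ∧ X.lines x = w ∧ (∀ j, lam • xm j ∈ X.denomLattice d) ∧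
          ∀ j, x j - lam • xm j ∈ (p.asIdeal * X.conjIdeal p.asIdeal) ^ N • X.denomLattice d := by
  classical
  obtain ⟨S, hS, hsupp⟩ := hsuppU
  obtain ⟨d, hd, hlat, hle, hxm, hst⟩ :=
    X.exists_stable_lattice S (fun L hL => (hS L hL).1) (Finset.univ.image xm)
  refine ⟨d, hd, hlat, fun j => hxm _ (Finset.mem_image.mpr ⟨j, Finset.mem_univ _, rfl⟩), hst, ?_⟩
  intro N w hw
  obtain ⟨lam, x, L, hL, hlam, hlamxm, hxL, hx⟩ := hsupp N w hw
  exact ⟨lam, x, hlam, hx, fun j => hle L hL (hlamxm j),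
    fun j => Submodule.smul_mono le_rfl (hle L hL) (hxL j)⟩

/-- The representatives of the support lie in the stable lattice itself: `x = λ • xm + δ` with `λ • xm ∈ L′` and
`δ ∈ (𝔭 𝔭̄)^N L′ ⊆ L′` (what the `Γ`-stable support set of the invariant route consumes). -/
theorem mem_denomLattice_of_suppU {d : 𝓞 X.E}
    {p : IsDedekindDomain.HeightOneSpectrum (NumberField.RingOfIntegers X.E)} {N : ℕ} {xm x : X.Tuple} {lam : X.E}
    (hlamxm : ∀ j, lam • xm j ∈ X.denomLattice d)
    (hx : ∀ j, x j - lam • xm j ∈ (p.asIdeal * X.conjIdeal p.asIdeal) ^ N • X.denomLattice d) (j : Fin 4) :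
    x j ∈ X.denomLattice d := by
  have hδ : x j - lam • xm j ∈ X.denomLattice d :=
    Submodule.smul_le_right (hx j)
  have := (X.denomLattice d).add_mem hδ (hlamxm j)
  simpa using this

/-- **(I2) FOR THE PER-SLOT SCALAR-UNION SUPPORT CLAUSE** in t4-x2 g2's `SuppU4` spelling (the text of record, S13492;
stated inline so that it applies to `hsupp : X.SuppU4 D p xm loc` by unfolding): ONE `Γ`-stable lattice `L′ = d⁻¹ 𝒪³ ∋ xm`
with the support of every depth inside `(l_j • xm_j)_j + (𝔭 𝔭̄)^N L′`, `l_j ≠ 0` per slot, `l_j • xm_j ∈ L′`.  Same proof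
as the one-scalar form. -/
theorem exists_stable_lattice_suppU_slot (D : X.ThetaData)
    {p : IsDedekindDomain.HeightOneSpectrum (NumberField.RingOfIntegers X.E)}
    {level : ℕ → X.Level} (loc : ∀ N : ℕ, X.Tr (level N)) (xm : X.Tuple)
    (hsupp : ∃ S : Finset (Submodule (NumberField.RingOfIntegers X.E) (Fin 3 → X.E)),
      (∀ L ∈ S, X.IsLattice L ∧ ∀ j, xm j ∈ L) ∧
      ∀ N (w : X.LineTuple), X.coefQ D.cf (loc N) (X.rep w) ≠ 0 →
        ∃ (l : Fin 4 → X.E) (x : X.Tuple) (L : Submodule (NumberField.RingOfIntegers X.E) (Fin 3 → X.E)), L ∈ S ∧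
          (∀ j, l j ≠ 0) ∧ (∀ j, l j • xm j ∈ L) ∧
          (∀ j, x j - l j • xm j ∈ (p.asIdeal * X.conjIdeal p.asIdeal) ^ N • L) ∧ X.lines x = w) :
    ∃ d : 𝓞 X.E, d ≠ 0 ∧ X.IsLattice (X.denomLattice d) ∧ (∀ j, xm j ∈ X.denomLattice d) ∧
      (∀ γ ∈ X.Γ, ∀ x ∈ X.denomLattice d, γ *ᵥ x ∈ X.denomLattice d) ∧
      ∀ N (w : X.LineTuple), X.coefQ D.cf (loc N) (X.rep w) ≠ 0 →
        ∃ (l : Fin 4 → X.E) (x : X.Tuple), (∀ j, l j ≠ 0) ∧ X.lines x = w ∧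
          (∀ j, l j • xm j ∈ X.denomLattice d) ∧
          ∀ j, x j - l j • xm j ∈ (p.asIdeal * X.conjIdeal p.asIdeal) ^ N • X.denomLattice d := by
  classical
  obtain ⟨S, hS, hsupp⟩ := hsupp
  obtain ⟨d, hd, hlat, hle, hxm, hst⟩ :=
    X.exists_stable_lattice S (fun L hL => (hS L hL).1) (Finset.univ.image xm)
  refine ⟨d, hd, hlat, fun j => hxm _ (Finset.mem_image.mpr ⟨j, Finset.mem_univ _, rfl⟩), hst, ?_⟩
  intro N w hw
  obtain ⟨l, x, L, hL, hl, hlxm, hxL, hx⟩ := hsupp N w hw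
  exact ⟨l, x, hl, hx, fun j => hle L hL (hlxm j),
    fun j => Submodule.smul_mono le_rfl (hle L hL) (hxL j)⟩

/-- The representatives of the per-slot support lie in the stable lattice itself. -/
theorem mem_denomLattice_of_suppU_slot {d : 𝓞 X.E}
    {p : IsDedekindDomain.HeightOneSpectrum (NumberField.RingOfIntegers X.E)} {N : ℕ} {xm x : X.Tuple}
    {l : Fin 4 → X.E} (hlxm : ∀ j, l j • xm j ∈ X.denomLattice d)
    (hx : ∀ j, x j - l j • xm j ∈ (p.asIdeal * X.conjIdeal p.asIdeal) ^ N • X.denomLattice d) (j : Fin 4) :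
    x j ∈ X.denomLattice d := by
  have hδ : x j - l j • xm j ∈ X.denomLattice d := Submodule.smul_le_right (hx j)
  have := (X.denomLattice d).add_mem hδ (hlxm j)
  simpa using this

/-- **(I2) FOR t4-L2-p3 g3's `SuppSlot`** (CrossMinor p679339; the per-slot conjunction grouped per slot), by name. -/
theorem exists_stable_lattice_suppSlot (D : X.ThetaData)
    {p : IsDedekindDomain.HeightOneSpectrum (NumberField.RingOfIntegers X.E)}
    {level : ℕ → X.Level} (loc : ∀ N : ℕ, X.Tr (level N)) (xm : X.Tuple) (hsupp : X.SuppSlot D p xm loc) :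
    ∃ d : 𝓞 X.E, d ≠ 0 ∧ X.IsLattice (X.denomLattice d) ∧ (∀ j, xm j ∈ X.denomLattice d) ∧
      (∀ γ ∈ X.Γ, ∀ x ∈ X.denomLattice d, γ *ᵥ x ∈ X.denomLattice d) ∧
      ∀ N (w : X.LineTuple), X.coefQ D.cf (loc N) (X.rep w) ≠ 0 →
        ∃ (l : Fin 4 → X.E) (x : X.Tuple), (∀ j, l j ≠ 0) ∧ X.lines x = w ∧
          (∀ j, l j • xm j ∈ X.denomLattice d) ∧
          ∀ j, x j - l j • xm j ∈ (p.asIdeal * X.conjIdeal p.asIdeal) ^ N • X.denomLattice d := by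
  classical
  obtain ⟨S, hS, hsupp⟩ := hsupp
  obtain ⟨d, hd, hlat, hle, hxm, hst⟩ :=
    X.exists_stable_lattice S (fun L hL => (hS L hL).1) (Finset.univ.image xm)
  refine ⟨d, hd, hlat, fun j => hxm _ (Finset.mem_image.mpr ⟨j, Finset.mem_univ _, rfl⟩), hst, ?_⟩
  intro N w hw
  obtain ⟨l, x, L, hL, hslot, hx⟩ := hsupp N w hw
  exact ⟨l, x, fun j => (hslot j).1, hx, fun j => hle L hL (hslot j).2.1,
    fun j => Submodule.smul_mono le_rfl (hle L hL) (hslot j).2.2⟩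

/-- The lines of `L′⁴` form a `Γ`-stable set of line tuples, for any `Γ`-stable lattice `L′ = d⁻¹ 𝒪³`. -/
theorem isGammaStable_linesOf_denomLattice {d : 𝓞 X.E} (hd : d ≠ 0) :
    X.IsGammaStable {w : X.LineTuple | ∃ x : X.Tuple, X.lines x = w ∧ ∀ j, x j ∈ X.denomLattice d} := by
  rintro γ hγ x ⟨x', hx', hx'L⟩
  obtain ⟨t, ht, hxt⟩ := X.exists_torus_of_lines_eq hx'.symm
  refine ⟨fun j => γ *ᵥ x' j, ?_, fun j => X.mulVec_mem_denomLattice hd hγ (hx'L j)⟩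
  funext j
  show Quot.mk _ (γ *ᵥ x' j) = Quot.mk _ (γ *ᵥ x j)
  rw [hxt j, Matrix.mulVec_smul]
  exact (Quot.sound ⟨t j, ht j, rfl⟩).symm

/-- **THE `Γ`-STABLE SUPPORT SET FOR `SuppSlot`** (what the family route displays, t4-L2-p3 g3 S13494): a `Γ`-stable set of
line tuples containing the support of every depth — the lines of `L′⁴`. -/
theorem exists_gammaStable_supportSet_of_suppSlot (D : X.ThetaData)
    {p : IsDedekindDomain.HeightOneSpectrum (NumberField.RingOfIntegers X.E)}
    {level : ℕ → X.Level} (loc : ∀ N : ℕ, X.Tr (level N)) (xm : X.Tuple) (hsupp : X.SuppSlot D p xm loc) :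
    ∃ S' : Set X.LineTuple, X.IsGammaStable S' ∧
      ∀ N (w : X.LineTuple), X.coefQ D.cf (loc N) (X.rep w) ≠ 0 → w ∈ S' := by
  obtain ⟨d, hd, -, -, -, hsuppd⟩ := X.exists_stable_lattice_suppSlot D loc xm hsupp
  refine ⟨{w | ∃ x : X.Tuple, X.lines x = w ∧ ∀ j, x j ∈ X.denomLattice d},
    X.isGammaStable_linesOf_denomLattice hd, fun N w hw => ?_⟩
  obtain ⟨l, x, -, hx, hlxm, hxL⟩ := hsuppd N w hw
  exact ⟨x, hx, fun j => X.mem_denomLattice_of_suppU_slot hlxm hxL j⟩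

/-- **THE `Γ`-STABLE SUPPORT SET FOR THE `SuppU4` SPELLING** (inline clause, applies to `X.SuppU4 D p xm loc` by unfolding). -/
theorem exists_gammaStable_supportSet_of_suppU_slot (D : X.ThetaData)
    {p : IsDedekindDomain.HeightOneSpectrum (NumberField.RingOfIntegers X.E)}
    {level : ℕ → X.Level} (loc : ∀ N : ℕ, X.Tr (level N)) (xm : X.Tuple)
    (hsupp : ∃ S : Finset (Submodule (NumberField.RingOfIntegers X.E) (Fin 3 → X.E)),
      (∀ L ∈ S, X.IsLattice L ∧ ∀ j, xm j ∈ L) ∧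
      ∀ N (w : X.LineTuple), X.coefQ D.cf (loc N) (X.rep w) ≠ 0 →
        ∃ (l : Fin 4 → X.E) (x : X.Tuple) (L : Submodule (NumberField.RingOfIntegers X.E) (Fin 3 → X.E)), L ∈ S ∧
          (∀ j, l j ≠ 0) ∧ (∀ j, l j • xm j ∈ L) ∧
          (∀ j, x j - l j • xm j ∈ (p.asIdeal * X.conjIdeal p.asIdeal) ^ N • L) ∧ X.lines x = w) :
    ∃ S' : Set X.LineTuple, X.IsGammaStable S' ∧
      ∀ N (w : X.LineTuple), X.coefQ D.cf (loc N) (X.rep w) ≠ 0 → w ∈ S' := by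
  obtain ⟨d, hd, -, -, -, hsuppd⟩ := X.exists_stable_lattice_suppU_slot D loc xm hsupp
  refine ⟨{w | ∃ x : X.Tuple, X.lines x = w ∧ ∀ j, x j ∈ X.denomLattice d},
    X.isGammaStable_linesOf_denomLattice hd, fun N w hw => ?_⟩
  obtain ⟨l, x, -, hx, hlxm, hxL⟩ := hsuppd N w hw
  exact ⟨x, hx, fun j => X.mem_denomLattice_of_suppU_slot hlxm hxL j⟩

end T4Data

end Summit.Ventures.HodgeRepro.Tier4.Line3

end
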